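import Summits.ValiantsHypothesis.ValiantsHypothesis.Theorems.NewtonUnitEquationsTwoProductsRaySplitDefs
import Summits.ValiantsHypothesis.ValiantsHypothesis.Theorems.NewtonUnitEquationsTwoProductsConfinedTameLawDefs

/-!
# val-idea-crit-8 (g2) — TYPED TEXT of the COEFFICIENT-CURRENCY TARGET OF RECORD (director-valiant R295 (2), 2026-08-28):
# the EXPONENTIAL-POLYNOMIAL MOMENT RECORD LAW (rung R12 candidate), for val-neg-1's pre-audit BEFORE any Defs file.
# NOT a tree write, NOT a claim, NO proof; statements only (all `def … : Prop`).  VP ≠ VNP is NOT proved; 5906 is OPEN.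
# rev 2 (val-neg-1 g5 pre-audit 20:57:39Z, scope remark (iv)): the shift is an INTEGER vector `d : Fin 2 → ℤ` (mixed-sign shifts such as
# `(3,−7)` are genuine members of idea-32's family and cannot be WLOG-ed into `ℕ²`); planar points of pairs `(S,k)` live in `ℤ²` (`ptZ`),
# weights are evaluated there (`wtZ`), and (B)'s membership clause reads `e = x i ∨ ∀ c, (e c : ℤ) = x i c + d c`.  c_S = (−1)^{|S|+1}(|S|−1)!/Π S_i! (neg-1 (iii)).

## The object (idea-32 g3 S6 20:12/20:16Z; = R11 Stage 2's `expPoly` layer, ✓ p661962 `expPoly_shift`; lead c3's dissociated engine at k = 0)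
Data: `2m` signed terms `j` (sides `u`/`v`), `n` CARRIERS `i` placed at `x i ∈ ℕ²`, ONE shift `d ∈ ℕ²`, and per term and carrier a
binomial `α j i + z·β j i` (the coefficients of the letters `x i` and `x i + d` in factor `j`).  The MOMENT POLYNOMIAL of a carrier
multiset `S : Fin n → ℕ` is `M(S) = Σ_j Π_i (α j i + z β j i)^{S i} − Σ_j Π_i (α' j i + z β' j i)^{S i} ∈ ℂ[z]`, its LAYERS
`F_k(S) = [z^k] M(S) = Σ_j ε_j α_j^S e_k(ρ_j | S)` (`ρ = β/α`; an exponential POLYNOMIAL of degree `k` in `S`; `k = 0`: pure exponential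
sums = the dissociated engine ✓ `TwoProducts.Dissociated.stub_engineDissociated`; `n = 1`: Disproof F4; `m = 1`: the UR corner).
For an instance whose tail alphabet lies in `X ⊔ (X + d)` with CARRIER-DISSOCIATION to depth `m` (`CarrierDissociated`: the planar point
`Σ_i S_i x_i + k d ∈ ℤ²`, `k ≤ |S| ≤ m`, determines `(S, k)`), the log-sum satisfies `[point (S,k)] D = c_S · F_k(S)` with
`c_S = (−1)^{|S|+1}(|S|−1)!·multinomial ≠ 0` (idea-32 g3, (y,z)-graded log-linearisation), so every visible point of every cell is the
image of a RECORD: a live pair `(S,k)` (`F_k(S) ≠ 0`) that is the strict `ξ`-top of all live shallow pairs for a weight `ξ` negative on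
every letter.  Hence `#S(cell) ≤ #records`, and records lie layerwise among the strict tops of `supp F_k` (`k ≤ m`).

## The statements typed below
* `LayerRecordLaw`  (A0, the lemma idea-32 pinned): for every `k ≤ m`, the strict tops of the shallow support of ONE layer `F_k`, over
  weights negative on all letters, number `≤ 2^(a m)(t+2)^b` — UNIFORMLY IN `k` (`a, b` absolute).  `k = 0` is the engine (known).
* `MomentRecordLaw` (A, coefficient currency, what the rung consumes): records of the whole live shallow set `≤ 2^(a m)(t+2)^b`.
  `LayerRecordLaw → MomentRecordLaw` is S-sized (a record is a top of its own layer; `m+1` layers) — typed as `momentRecord_of_layerRecord`.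
* `ShiftedCarrierLaw` (B, the RUNG in the ladder's currency): per-cell law for instances with tail alphabet in `X ⊔ (X+d)`, carrier-dissociated.
  `MomentRecordLaw → ShiftedCarrierLaw` is M-sized (the graded log-linearisation above + `visible → logVisible`) — typed as `shiftedCarrier_of_momentRecord`.
  First uncovered members: `n ≥ 3` carriers (rank `n−1` exchange lattice, ONE block of `2n ≍ t` letters: no `RankOneCoincidences` (two exchanges
  on 3 carriers are non-proportional), not `PermType`, not confined-tame for `n > Cm`, on no `≤ C` rays, not block-graded with small blocks).

## What is deliberately NOT claimed (and why)
* NOT general polynomial weights: «`Σ_j ε_j α_j^S P_j(S)`, `deg P_j ≤ k`» is FALSE as a record law already for equal bases — with `α = α'`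
  and `k = m` the difference `P − P'` interpolates ARBITRARY values on `{|S| ≤ m}` (dim of degree-`≤ m` polynomials in `n` variables =
  `C(n+m, m)` = number of shallow `S`), so the live set is an arbitrary subset of a dissociated digit simplex and carries `t^{Ω(m)}`-type convex
  chains.  The law can only hold for the BINOMIAL-SHIFT structure `e_k(ρ_j | S)` with the SAME `(α, β)` serving every layer — typed so.
* NOT `t`-free, NOT `m`-free (Disproof `not_twoProductsBoundFreeOfM/T` respected: both parameters are in the bound).
* Competitors are the live SHALLOW pairs only (`|S'| ≤ m`); the true log-support also has deeper points, which can only kill records —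
  so (A) is an UPPER bound for (B)'s visible count and possibly STRONGER than (B).  Pre-audit question Q1 below.

## For val-neg-1's pre-audit (R295 (2): inertness / costume / small cases) — the questions I would ask
Q0 INERTNESS: (B) is a positive class-coverage rung; as a HATCH `¬(∃ x d, alphabet ⊆ X ⊔ (X+d) ∧ CarrierDissociated)` it is inert by the
   T6/T8/T9 mechanism (a common tower in a fresh direction leaves the class) — forecast, nothing to audit; the CURRENCY change is (A):
   a statement about `(α, β, x, d)`-data, not about instances, to which padding does not apply.
Q1 COSTUME / STRENGTH: every (B)-instance yields (A)-data and every (A)-datum comes from a (B)-instance (`u_j := Σ_i α j i X^{x i} + β j i X^{x i + d}`),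
   so (A) is (B) with the deep competitors and the cell-order consistency REMOVED — is that removal harmless?  Toy: `n = 3,4`, `m = 2,3`, integer
   data in `[-3,3]`, count records (A) vs visible points (B); any datum with records > visible by more than a constant factor is informative,
   records growing faster than law-shape would KILL (A) while leaving (B) open.
Q2 k-UNIFORMITY (the real question): for `m = 3`, `n = 4…6`, maximise `T_k` = strict tops of layer `k` over integer data, `k = 0…3`; idea-35 g2 §7
   predicts dent depth `≤ 2m−1` per edge direction on the top layer `|S| = k` and `≤ 2m(k+1)−1` in general (univariate recurrence order) —
   growth of `max_k T_k` faster than `T_0`'s engine bound `(s²+2)(2m)4^{2m−1}` by more than `poly(m)` would be the first evidence against uniformity.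
Q3 DEGENERATE ENDS (paper, done): `n = 1` (F4 two-letter tower-free pair: law ✓), `k = 0` (engine ✓), `m = 1` (UR corner ✓), `β = 0` (no shifted
   letter: dissociated instance ✓), `α = 0` on a carrier (pure shifted letter: swap roles `x ↔ x+d`, `z ↦ 1/z` symmetry of the statement ✓).
These fold into the ONE batched WAVE-3 job of R289 (1)/R295 (2) as two columns (records, max_k T_k) on the «X ⊔ (X+d), n = 3…6, m = 3» designs.
-/

set_option linter.dupNamespace false

noncomputable section

open Classical

namespace Summit.ValiantsHypothesis.ValiantsHypothesis.Theorems.NewtonUnitEquations.TwoProducts.MomentRecord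
open scoped BigOperators
open Summit.ValiantsHypothesis.ValiantsHypothesis.Theorems.NewtonUnitEquations.TwoProducts.FormalLogLinearisation
open Summit.ValiantsHypothesis.ValiantsHypothesis.Theorems.NewtonUnitEquations.TwoProducts.PlanarCell

variable {m n : ℕ}

/-- The one-sided moment polynomial `Σ_j Π_i (α j i + z β j i)^{S i} ∈ ℂ[z]` of a carrier multiset `S`. -/
def momentPoly (α β : Fin m → Fin n → ℂ) (S : Fin n → ℕ) : Polynomial ℂ :=
  ∑ j, ∏ i, (Polynomial.C (α j i) + Polynomial.X * Polynomial.C (β j i)) ^ (S i)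

/-- LAYER `k` of the signed moment polynomial: `F_k(S) = [z^k] (M_u(S) − M_v(S)) = Σ_j ε_j α_j^S e_k(β_j/α_j | S)`. -/
def layer (α β α' β' : Fin m → Fin n → ℂ) (k : ℕ) (S : Fin n → ℕ) : ℂ :=
  (momentPoly α β S - momentPoly α' β' S).coeff k

/-- Number of letters of a carrier multiset. -/
def size (S : Fin n → ℕ) : ℕ := ∑ i, S i

/-- The weight of an INTEGER planar point (`wt` extended to `ℤ²`). -/
def wtZ (ξ : Fin 2 → ℝ) (p : Fin 2 → ℤ) : ℝ := ξ 0 * ((p 0 : ℤ) : ℝ) + ξ 1 * ((p 1 : ℤ) : ℝ)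

/-- The shifted letter `x_i + d` as an integer point (rev 2: `d ∈ ℤ²`). -/
def shiftZ (x : Fin n → Expo) (d : Fin 2 → ℤ) (i : Fin n) : Fin 2 → ℤ :=
  fun c => ((x i c : ℕ) : ℤ) + d c

/-- The planar point of the pair `(S, k)` in `ℤ²`: `Σ_i S_i • x_i + k • d` (`k` of the `|S|` letters are the shifted copies `x_i + d`). -/
def ptZ (x : Fin n → Expo) (d : Fin 2 → ℤ) (S : Fin n → ℕ) (k : ℕ) : Fin 2 → ℤ :=
  fun c => (∑ i, ((S i : ℕ) : ℤ) * ((x i c : ℕ) : ℤ)) + (k : ℤ) * d c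

/-- CARRIER-DISSOCIATION to depth `m`: a planar point with at most `m` letters determines its carrier multiset AND its number of shifted
letters (the relation lattice of `X ⊔ (X+d)` is generated by the exchanges `(x+d) + x' = x + (x'+d)` and nothing else, up to depth `m`). -/
def CarrierDissociated (x : Fin n → Expo) (d : Fin 2 → ℤ) (m : ℕ) : Prop :=
  ∀ (S S' : Fin n → ℕ) (k k' : ℕ), size S ≤ m → size S' ≤ m → k ≤ size S → k' ≤ size S' →
    ptZ x d S k = ptZ x d S' k' → S = S' ∧ k = k'

/-- Weights negative on every letter `x_i` and `x_i + d` (the image of `ValidWeight` for an alphabet inside `X ⊔ (X+d)`). -/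
def NegWeight (x : Fin n → Expo) (d : Fin 2 → ℤ) (ξ : Fin 2 → ℝ) : Prop :=
  ∀ i, wt ξ (x i) < 0 ∧ wtZ ξ (shiftZ x d i) < 0

/-- Term `j` uses at most `t` carriers (the image of `t`-sparsity of the factor). -/
def TermSparse (α β : Fin m → Fin n → ℂ) (t : ℕ) : Prop :=
  ∀ j, (Finset.univ.filter fun i => α j i ≠ 0 ∨ β j i ≠ 0).card ≤ t

/-- The finite box of shallow pairs `(S, k)`: entries of `S` and `k` at most `m` (a superset of `{|S| ≤ m, k ≤ |S|}`). -/
def shallowPairs (n m : ℕ) : Finset ((Fin n → ℕ) × ℕ) :=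
  (Fintype.piFinset fun _ : Fin n => Finset.range (m + 1)) ×ˢ Finset.range (m + 1)

/-- The finite box of shallow carrier multisets. -/
def shallowSets (n m : ℕ) : Finset (Fin n → ℕ) :=
  Fintype.piFinset fun _ : Fin n => Finset.range (m + 1)

/-- The LIVE shallow pairs: `|S| ≤ m`, `k ≤ |S|`, `F_k(S) ≠ 0`. -/
def live (α β α' β' : Fin m → Fin n → ℂ) (m' : ℕ) : Set ((Fin n → ℕ) × ℕ) :=
  {p | size p.1 ≤ m' ∧ p.2 ≤ size p.1 ∧ layer α β α' β' p.2 p.1 ≠ 0}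

/-- `(S, k)` is a RECORD for the weight `ξ`: live, and strictly heavier than every other live shallow pair. -/
def IsRecord (α β α' β' : Fin m → Fin n → ℂ) (x : Fin n → Expo) (d : Fin 2 → ℤ) (m' : ℕ) (ξ : Fin 2 → ℝ)
    (p : (Fin n → ℕ) × ℕ) : Prop :=
  p ∈ live α β α' β' m' ∧ ∀ q ∈ live α β α' β' m', q ≠ p → wtZ ξ (ptZ x d q.1 q.2) < wtZ ξ (ptZ x d p.1 p.2)

/-- `S` is a LAYER-`k` TOP for the weight `ξ`: `F_k(S) ≠ 0`, `|S| ≤ m`, and strictly heavier than every other shallow `S'` with `F_k(S') ≠ 0`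
(the shift `k • d` is common to the layer, so only the carrier weights compete). -/
def IsLayerTop (α β α' β' : Fin m → Fin n → ℂ) (x : Fin n → Expo) (m' k : ℕ) (ξ : Fin 2 → ℝ) (S : Fin n → ℕ) : Prop :=
  size S ≤ m' ∧ layer α β α' β' k S ≠ 0 ∧
    ∀ S' : Fin n → ℕ, size S' ≤ m' → S' ≠ S → layer α β α' β' k S' ≠ 0 → wtZ ξ (ptZ x 0 S' 0) < wtZ ξ (ptZ x 0 S 0)

/-- **(A0) LAYER RECORD LAW** — the lemma idea-32 g3 pinned («bound the distinct-letter strict tops of `supp F_k` by a law-shaped function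
UNIFORMLY IN `k`»): absolute `a, b` such that for every `k ≤ m` the layer-`k` tops over letter-negative weights number `≤ 2^(a m)(t+2)^b`.
`k = 0` is lead c3's dissociated engine (✓ `stub_engineDissociated`, bound `(s²+2)(2m)4^{2m−1}`). -/
def LayerRecordLaw : Prop :=
  ∃ a b : ℕ, ∀ (m n t k : ℕ) (α β α' β' : Fin m → Fin n → ℂ) (x : Fin n → Expo) (d : Fin 2 → ℤ),
    2 ≤ t → TermSparse α β t → TermSparse α' β' t → n ≤ 2 * m * t → k ≤ m →
    CarrierDissociated x d m →
    ((shallowSets n m).filter fun S => ∃ ξ : Fin 2 → ℝ, NegWeight x d ξ ∧ IsLayerTop α β α' β' x m k ξ S).card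
      ≤ 2 ^ (a * m) * (t + 2) ^ b

/-- **(A) MOMENT RECORD LAW** (coefficient currency; what the rung consumes): the records of the live shallow set over letter-negative weights
number `≤ 2^(a m)(t+2)^b`, `a, b` absolute. -/
def MomentRecordLaw : Prop :=
  ∃ a b : ℕ, ∀ (m n t : ℕ) (α β α' β' : Fin m → Fin n → ℂ) (x : Fin n → Expo) (d : Fin 2 → ℤ),
    2 ≤ t → TermSparse α β t → TermSparse α' β' t → n ≤ 2 * m * t →
    CarrierDissociated x d m →
    ((shallowPairs n m).filter fun p => ∃ ξ : Fin 2 → ℝ, NegWeight x d ξ ∧ IsRecord α β α' β' x d m ξ p).card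
      ≤ 2 ^ (a * m) * (t + 2) ^ b

/-- (A0) ⇒ (A), S-sized: a record `(S, k)` is a layer-`k` top for the same weight (same-layer competitors share the shift `k • d`), and there are
`m + 1` layers.  Typed target, not proved here. -/
def momentRecord_of_layerRecord : Prop := LayerRecordLaw → MomentRecordLaw

/-- **(B) SHIFTED-CARRIER LAW — the RUNG in the ladder's currency**: instances whose tail alphabet lies in `X ⊔ (X + d)` for carriers `x` and one
shift `d`, carrier-dissociated to depth `m`, obey the per-cell law.  (First members outside every landed rung and outside K10's block-graded
class: `n ≥ 3` carriers.) -/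
def ShiftedCarrierLaw : Prop :=
  ∃ a b : ℕ, ∀ (m t n : ℕ) (u v : Fin m → MvPolynomial (Fin 2) ℂ) (x : Fin n → Expo) (d : Fin 2 → ℤ),
    2 ≤ t →
    (∀ j, MvPolynomial.coeff 0 (u j) = 0 ∧ (u j).support.card ≤ t) →
    (∀ j, MvPolynomial.coeff 0 (v j) = 0 ∧ (v j).support.card ≤ t) →
    (∀ e ∈ tailSupport u v, ∃ i, e = x i ∨ ∀ c, ((e c : ℕ) : ℤ) = shiftZ x d i c) →
    CarrierDissociated x d m →
    ∀ (R : Expo → Expo → Prop) (S : Finset Expo), IsCellFamily u v R S → S.card ≤ 2 ^ (a * m) * (t + 2) ^ b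

/-- (A) ⇒ (B), M-sized: with `α j i := [X^{x i}] u_j`, `β j i := [X^{x i + d}] u_j` (resp. `v`), the graded log-linearisation gives
`logDiff u v e = c_S · layer k S` at the (natural-number) point `e` with `(e : ℤ²) = ptZ x d S k`, `c_S = (−1)^{|S|+1}(|S|−1)!/Π S_i! ≠ 0` for `|S| ≤ m` (carrier-dissociation makes the `(S,k)`-fibre of a shallow point a
singleton up to the exchange relations, on which the universal log constant is constant), a visible point is log-visible (`visible_iff_logVisible`),
hence the image of a record, and `ptZ x d` is injective on live shallow pairs.  Typed target, not proved here. -/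
def shiftedCarrier_of_momentRecord : Prop := MomentRecordLaw → ShiftedCarrierLaw

end Summit.ValiantsHypothesis.ValiantsHypothesis.Theorems.NewtonUnitEquations.TwoProducts.MomentRecord

end
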